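import Summits.Ventures.CertifiedManyBodySolver.Cruxes.ThermalStiffnessCeilingU8b10_le_1o8.Disproof
import HarnessLib

/-!
# BN-decomp-1 — the FLOOR-SET normal form of K1: «every super-⅛ floor set of sizes is FINITE» (its finite-size cousin: «EMPTY»)

Planner `hubbard-floor-idea-decomp` g3 (lens = decomposition-first; zero kit; no routes). By-product of the cycle-4 found-nothing pass
on K1 = `TcThermcert1.ThermalStiffnessCeilingU8b10_le_1o8` (stmt-Ventures-26381). HONEST FRAMING: pure bookkeeping about the LOGICAL SHAPE
of a one-sided ceiling statement; nothing about superconductivity in the Hubbard model is proved or disproved here; no number below is a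
cell of record; the only numerical inputs mentioned in comments are FLOATS of other seats, labelled as such. Every statement is sorry-free.

THE NORMAL FORM. For an anchor `(t′, U, n, β)`, a trial constant `ρ` and a window `θ₀` let
  `floorSet t′ U n β ρ θ₀ := { L ≥ 1 : β·ρ·θ² ≤ g_L(θ) for every |θ| ≤ θ₀ }`,   `g_L(θ) = log Z_L(0) − log Z_L(θ)` (K1's flux cost).
Then (all kernel-checked below):
* `leaf_iff_bddAbove` : `ObsThermalStiffnessSeqCeilingAtBeta t′ U n β c ↔ ∀ ρ > max(c, 0), ∀ θ₀ > 0, floorSet … ρ θ₀ is BOUNDED (= finite)`;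
  in particular `k1_iff_finite` : **K1 ⇔ every floor set with ρ > 1/8 is a FINITE set of sizes**;
* `k1WithoutTendstoPos_iff_empty` : the disprover's honest finite-size variant `K1WithoutTendstoPos` (Disproof v4 (a)) ⇔ every floor set with
  ρ > 1/8 is EMPTY — so the two statements differ exactly by «finite» vs «empty», and `k1_of_k1WithoutTendstoPos` is the inclusion;
* `k1_iff_eventually_dip` : K1 ⇔ ∀ ρ > 1/8, ∀ θ₀ > 0, EVENTUALLY IN L some |θ| ≤ θ₀ has `g_L(θ) < 10ρθ²` (each dip one finite-torus
  inequality; the «eventually, for every slope and window» is the thermodynamic-limit content);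
* `k1_of_pointwise_eventual_ceiling` : the PRODUCER SOCKET — K1 ⇐ along one null sequence of non-zero twists θ_k, eventually in L,
  `g_L(θ_k) ≤ (5/4)θ_k²` (one eventual pointwise ceiling per twist; the shape a future thermodynamic-limit T > 0 datum must have);
* `k1_iff_tail` : K1 ⇔ the same with every floor set cut to `L ≥ L₀`, for ANY `L₀` — **no finite collection of certified cluster sizes
  bears on K1 either way** (the typed form of CENSUS-idea-decomp-r2 §1's corollary «every valid split keeps a thermodynamic-limit piece»:
  here K1 is literally a countable conjunction of TL-finiteness statements, `k1_iff_countable`, one per `m`, with `ρ_m = 1/8 + 1/(m+1)`,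
  `θ_m = 1/(m+1)`, antitone in `m`);
* SOCKETS where certified finite tori are booked AS INSTANCES (never as evidence for/against K1): `mem_floorSet_of_quadFloor` (a certified
  quadratic floor `a θ² ≤ g_L` with `β ρ ≤ a` puts `L` IN), `not_mem_floorSet_of_nonpos` (one certified non-positive value `g_L(θ₁) ≤ 0`,
  `0 < |θ₁| ≤ θ₀`, keeps `L` OUT of every positive floor set — the paramagnetic open-shell sizes, e.g. the 4×4 float `R_4(8) = −0.221`),
  and the commissioned CERT-3×3 (FL-RULING 25, object `TendstoDeciderL3.CertFluxCost3x3Floor`, used here UNFOLDED): `mem_floorSet_three_of_cert3` puts `3 ∈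
  floorSet 0 8 (7/8) 10 (1/5) (1/100)` (hence `∈ floorSet_m` for `m = 99`), which is exactly WHY it decides `K1WithoutTendstoPos` in the
  negative (`not_k1WithoutTendstoPos_of_cert3'`, re-derived through the normal form) and exactly why it says NOTHING about K1 (`k1_iff_tail 4`).
READING. K1 predicts: beyond some `L₀(ρ, θ₀)` NO torus — closed-shell (diamagnetic) or open-shell — keeps a uniform quadratic flux floor of
slope `10ρ > 5/4` on a window; the cell's certified instruments can populate floor sets at `L = 3` (and in sign at paramagnetic sizes) but a
finiteness statement over all large `L` is a thermodynamic-limit input, for which no producer exists at today's prices (KILL-3(i) pending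
kgripN). v1.1 (2026-08-28T20:40Z): + `k1_of_pointwise_eventual_ceiling` (producer socket). SC in the Hubbard model is NOT proved by anything here.
-/

noncomputable section

namespace Summit.Ventures.CertifiedManyBodySolver.Cruxes.ThermalStiffnessCeilingU8b10_le_1o8.FloorSetNormalForm

open Real Filter Set Topology
open Summit.Ventures.CertifiedManyBodySolver.Observables
open Summit.Ventures.CertifiedManyBodySolver.Theses
open Summit.Ventures.CertifiedManyBodySolver.Cruxes.ThermalStiffnessCeilingU8b10_le_1o8.Disproof

/-! ## §1 The floor set and its monotonicity -/

/-- The flux cost of the `L×L` torus at anchor `(t′, U, n, β)`: `g_L(θ) = log Z_L(0) − log Z_L(θ)` on K1's canonical sector. -/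
abbrev fluxCostAt (tp U n β : ℝ) (L : ℕ) [NeZero L] (θ : ℝ) : ℝ :=
  thermalFluxLogZ L tp U (1 - n) β 0 - thermalFluxLogZ L tp U (1 - n) β θ

/-- **Floor set**: the positive sizes `L` at which the quadratic flux floor `β ρ θ² ≤ g_L(θ)` holds on the whole window `|θ| ≤ θ₀`. -/
def floorSet (tp U n β ρ θ₀ : ℝ) : Set ℕ :=
  {L | ∃ _ : NeZero L, ∀ θ : ℝ, |θ| ≤ θ₀ →
    β * ρ * θ ^ 2 ≤ thermalFluxLogZ L tp U (1 - n) β 0 - thermalFluxLogZ L tp U (1 - n) β θ}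

/-- Membership read-back with an ambient `NeZero L` instance. -/
theorem mem_floorSet_iff {tp U n β ρ θ₀ : ℝ} {L : ℕ} [NeZero L] :
    L ∈ floorSet tp U n β ρ θ₀ ↔ ∀ θ : ℝ, |θ| ≤ θ₀ → β * ρ * θ ^ 2 ≤ fluxCostAt tp U n β L θ := by
  constructor
  · rintro ⟨_, h⟩ θ hθ
    exact h θ hθ
  · intro h
    exact ⟨inferInstance, h⟩

/-- Floor sets GROW when the slope `ρ` or the window `θ₀` shrinks (`0 ≤ β`). -/
theorem floorSet_anti {tp U n β ρ ρ' θ₀ θ₀' : ℝ} (hβ : 0 ≤ β) (hρ : ρ' ≤ ρ) (hθ : θ₀' ≤ θ₀) :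
    floorSet tp U n β ρ θ₀ ⊆ floorSet tp U n β ρ' θ₀' := by
  rintro L ⟨inst, h⟩
  refine ⟨inst, fun θ hθ' => ?_⟩
  have h1 := h θ (hθ'.trans hθ)
  have h2 : β * ρ' * θ ^ 2 ≤ β * ρ * θ ^ 2 := by
    have : 0 ≤ β * θ ^ 2 := mul_nonneg hβ (sq_nonneg θ)
    nlinarith
  exact h2.trans h1

/-- A bounded set of sizes is a finite set of sizes (and conversely). -/
theorem bddAbove_iff_finite {s : Set ℕ} : BddAbove s ↔ s.Finite := by
  constructor
  · rintro ⟨M, hM⟩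
    exact (Set.finite_Iic M).subset fun x hx => hM hx
  · exact Set.Finite.bddAbove

/-! ## §2 The normal form of the single-temperature leaf -/

/-- **Normal form.** The thermal stiffness leaf at `β` with constant `c` holds iff for every slope `ρ > c` (`ρ > 0`) and every window
`θ₀ > 0` the floor set is bounded. (`→`: an unbounded floor set enumerates into a divergent sequence satisfying the premise; `←`: a
divergent sequence satisfying the premise eventually exceeds any bound of the floor set it lives in.) -/
theorem leaf_iff_bddAbove {tp U n β : ℝ} {c : ℚ} :
    ObsThermalStiffnessSeqCeilingAtBeta tp U n β c ↔
      ∀ ρ θ₀ : ℝ, ((c : ℚ) : ℝ) < ρ → 0 < ρ → 0 < θ₀ → BddAbove (floorSet tp U n β ρ θ₀) := by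
  constructor
  · intro h ρ θ₀ hc hρ hθ
    by_contra hnb
    rw [not_bddAbove_iff] at hnb
    choose Ls hmem hlt using hnb
    have hLs : Tendsto Ls atTop atTop := tendsto_atTop_mono (fun j => (hlt j).le) tendsto_id
    have hprem : ∀ (j : ℕ) [NeZero (Ls j)] (θ : ℝ), |θ| ≤ θ₀ →
        β * ρ * θ ^ 2 ≤ thermalFluxLogZ (Ls j) tp U (1 - n) β 0 - thermalFluxLogZ (Ls j) tp U (1 - n) β θ := by
      intro j _ θ hθ'
      obtain ⟨_, hfl⟩ := hmem j
      exact hfl θ hθ'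
    exact absurd (h ρ θ₀ hρ hθ Ls hLs hprem) (not_le.2 hc)
  · intro h ρs θ₀ hρ hθ Ls hLs hprem
    by_contra hlt
    push Not at hlt
    obtain ⟨M, hM⟩ := h ρs θ₀ hlt hρ hθ
    obtain ⟨j, hj⟩ := (hLs.eventually (eventually_gt_atTop M)).exists
    haveI : NeZero (Ls j) := ⟨by omega⟩
    have hmemb : Ls j ∈ floorSet tp U n β ρs θ₀ := ⟨inferInstance, fun θ hθ' => hprem j θ hθ'⟩
    exact absurd (hM hmemb) (not_le.2 hj)

/-- **K1 ⇔ every super-⅛ floor set is bounded.** -/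
theorem k1_iff_bddAbove :
    TcThermcert1.ThermalStiffnessCeilingU8b10_le_1o8 ↔
      ∀ ρ θ₀ : ℝ, 1 / 8 < ρ → 0 < θ₀ → BddAbove (floorSet 0 8 (7 / 8) 10 ρ θ₀) := by
  rw [show TcThermcert1.ThermalStiffnessCeilingU8b10_le_1o8 = ObsThermalStiffnessSeqCeilingAtBeta 0 8 (7 / 8) 10 (1 / 8) from rfl,
    leaf_iff_bddAbove]
  push_cast
  constructor
  · intro h ρ θ₀ hρ hθ
    exact h ρ θ₀ hρ (by linarith) hθ
  · intro h ρ θ₀ hρ _ hθ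
    exact h ρ θ₀ hρ hθ

/-- **K1 ⇔ every super-⅛ floor set is a FINITE set of sizes.** -/
theorem k1_iff_finite :
    TcThermcert1.ThermalStiffnessCeilingU8b10_le_1o8 ↔
      ∀ ρ θ₀ : ℝ, 1 / 8 < ρ → 0 < θ₀ → (floorSet 0 8 (7 / 8) 10 ρ θ₀).Finite := by
  rw [k1_iff_bddAbove]
  simp only [bddAbove_iff_finite]

/-- **K1 ignores every bounded range of sizes**: for any `L₀`, K1 ⇔ every super-⅛ floor set cut to `L ≥ L₀` is bounded. Hence no finite
collection of certified tori (in or out of floor sets) bears on K1. -/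
theorem k1_iff_tail (L₀ : ℕ) :
    TcThermcert1.ThermalStiffnessCeilingU8b10_le_1o8 ↔
      ∀ ρ θ₀ : ℝ, 1 / 8 < ρ → 0 < θ₀ → BddAbove (floorSet 0 8 (7 / 8) 10 ρ θ₀ ∩ Ici L₀) := by
  rw [k1_iff_bddAbove]
  refine forall₄_congr fun ρ θ₀ _ _ => ⟨fun h => h.mono inter_subset_left, fun ⟨M, hM⟩ => ⟨max M L₀, fun L hL => ?_⟩⟩
  rcases le_or_gt L₀ L with h1 | h1
  · exact (hM ⟨hL, h1⟩).trans (le_max_left _ _)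
  · exact h1.le.trans (le_max_right _ _)

/-- Bounded ⇔ eventually absent (sets of sizes). -/
theorem bddAbove_iff_eventually_not_mem {s : Set ℕ} : BddAbove s ↔ ∀ᶠ L in atTop, L ∉ s := by
  rw [eventually_atTop]
  constructor
  · rintro ⟨M, hM⟩
    exact ⟨M + 1, fun L hL hLs => absurd (hM hLs) (by omega)⟩
  · rintro ⟨M, hM⟩
    refine ⟨M, fun L hLs => ?_⟩
    by_contra hML
    push Not at hML
    exact hM L hML.le hLs

/-- **Eventual-dip form** (the quotable one): K1 ⇔ for every slope `ρ > 1/8` and every window `θ₀ > 0`, EVENTUALLY IN `L` some twist of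
the window dips strictly below the parabola, `g_L(θ) < 10ρθ²`. Each dip is ONE finite-torus inequality (certifiable at small `L`); the
«eventually, for every slope and window» is the thermodynamic-limit content no finite family of certificates supplies. -/
theorem k1_iff_eventually_dip :
    TcThermcert1.ThermalStiffnessCeilingU8b10_le_1o8 ↔
      ∀ ρ θ₀ : ℝ, 1 / 8 < ρ → 0 < θ₀ →
        ∀ᶠ L : ℕ in atTop, ∀ [NeZero L], ∃ θ : ℝ, |θ| ≤ θ₀ ∧ fluxCostAt 0 8 (7 / 8) 10 L θ < 10 * ρ * θ ^ 2 := by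
  rw [k1_iff_bddAbove]
  refine forall₄_congr fun ρ θ₀ _ _ => ?_
  rw [bddAbove_iff_eventually_not_mem]
  refine eventually_congr (Eventually.of_forall fun L => ⟨fun hL inst => ?_, fun h hL => ?_⟩)
  · by_contra hno
    push Not at hno
    exact hL ⟨inst, hno⟩
  · obtain ⟨inst, hfl⟩ := hL
    obtain ⟨θ, hθ, hlt⟩ := @h inst
    exact absurd (hfl θ hθ) (not_le.2 hlt)

/-- **Countable normal form**: it suffices to test the slopes `ρ_m = 1/8 + 1/(m+1)` on the windows `θ_m = 1/(m+1)`; K1 is the countable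
conjunction `⋀_m FIN(m)`, `FIN(m) := (floorSet 0 8 (7/8) 10 ρ_m θ_m).Finite`, and `FIN` is antitone along `m` (`fin_antitone`). -/
theorem k1_iff_countable :
    TcThermcert1.ThermalStiffnessCeilingU8b10_le_1o8 ↔
      ∀ m : ℕ, (floorSet 0 8 (7 / 8) 10 (1 / 8 + 1 / ((m : ℝ) + 1)) (1 / ((m : ℝ) + 1))).Finite := by
  rw [k1_iff_finite]
  constructor
  · intro h m
    have hm : (0 : ℝ) < 1 / ((m : ℝ) + 1) := by positivity
    exact h _ _ (by linarith) hm
  · intro h ρ θ₀ hρ hθ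
    obtain ⟨m, hm⟩ := exists_nat_one_div_lt (lt_min (sub_pos.2 hρ) hθ)
    have hm1 : 1 / ((m : ℝ) + 1) < ρ - 1 / 8 := hm.trans_le (min_le_left _ _)
    have hm2 : 1 / ((m : ℝ) + 1) < θ₀ := hm.trans_le (min_le_right _ _)
    exact (h m).subset (floorSet_anti (by norm_num) (by linarith) hm2.le)

/-- `FIN(m+1) → FIN(m)`: the test sets grow with `m`. -/
theorem fin_antitone (m : ℕ)
    (h : (floorSet 0 8 (7 / 8) 10 (1 / 8 + 1 / ((((m + 1 : ℕ)) : ℝ) + 1)) (1 / ((((m + 1 : ℕ)) : ℝ) + 1))).Finite) :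
    (floorSet 0 8 (7 / 8) 10 (1 / 8 + 1 / ((m : ℝ) + 1)) (1 / ((m : ℝ) + 1))).Finite := by
  refine h.subset (floorSet_anti (by norm_num) ?_ ?_)
  · push_cast
    have : (1 : ℝ) / ((m : ℝ) + 1 + 1) ≤ 1 / ((m : ℝ) + 1) :=
      one_div_le_one_div_of_le (by positivity) (by linarith)
    linarith
  · push_cast
    exact one_div_le_one_div_of_le (by positivity) (by linarith)

/-- **Producer socket (sufficient, pointwise form).** If along ONE null sequence of non-zero twists `θ_k → 0` the flux cost is EVENTUALLY
(in `L`) at most the K1 parabola, `g_L(θ_k) ≤ (5/4)·θ_k²` (slope `5/4 = 10·(1/8)`, non-strict), then K1 holds: every window contains some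
`θ_k`, and `(5/4)θ_k² < 10ρθ_k²` for every `ρ > 1/8`. This is the exact shape a future thermodynamic-limit T > 0 producer must output to feed
K1 through this file — ONE eventual pointwise ceiling per twist of a null sequence; no uniformity in a window is needed on the input side. -/
theorem k1_of_pointwise_eventual_ceiling (θk : ℕ → ℝ) (hne : ∀ k, θk k ≠ 0) (hT : Tendsto θk atTop (𝓝 0))
    (h : ∀ k, ∀ᶠ L : ℕ in atTop, ∀ [NeZero L], fluxCostAt 0 8 (7 / 8) 10 L (θk k) ≤ 5 / 4 * θk k ^ 2) :
    TcThermcert1.ThermalStiffnessCeilingU8b10_le_1o8 := by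
  rw [k1_iff_eventually_dip]
  intro ρ θ₀ hρ hθ
  obtain ⟨N, hN⟩ := Metric.tendsto_atTop.1 hT θ₀ hθ
  have hk : |θk N| < θ₀ := by simpa [Real.dist_eq] using hN N le_rfl
  filter_upwards [h N] with L hL
  intro inst
  refine ⟨θk N, hk.le, (@hL inst).trans_lt ?_⟩
  have h2 : 0 < θk N ^ 2 := sq_pos_iff.2 (hne N)
  nlinarith

/-! ## §3 The finite-size cousin: «empty» instead of «finite» -/

/-- **`K1WithoutTendstoPos` ⇔ every super-⅛ floor set is EMPTY.** -/
theorem k1WithoutTendstoPos_iff_empty :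
    K1WithoutTendstoPos ↔ ∀ ρ θ₀ : ℝ, 1 / 8 < ρ → 0 < θ₀ → floorSet 0 8 (7 / 8) 10 ρ θ₀ = ∅ := by
  constructor
  · intro h ρ θ₀ hρ hθ
    refine eq_empty_iff_forall_notMem.2 fun L hL => ?_
    obtain ⟨inst, hfl⟩ := hL
    have h1 := h ρ θ₀ (by linarith) hθ (fun _ => L) (fun _ => Nat.pos_of_ne_zero (NeZero.ne L))
      (fun j _ θ hθ' => hfl θ hθ')
    push_cast at h1
    linarith
  · intro h ρs θ₀ hρ hθ Ls hpos hprem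
    by_contra hlt
    push Not at hlt
    push_cast at hlt
    haveI : NeZero (Ls 0) := ⟨(hpos 0).ne'⟩
    have hmem : Ls 0 ∈ floorSet 0 8 (7 / 8) 10 ρs θ₀ := ⟨inferInstance, fun θ hθ' => hprem 0 θ hθ'⟩
    rw [h ρs θ₀ hlt hθ] at hmem
    exact hmem

/-- The inclusion «empty ⇒ finite»: the finite-size variant implies K1 (junk-free companion of `Disproof.k1_of_withoutTendsto`). -/
theorem k1_of_k1WithoutTendstoPos (h : K1WithoutTendstoPos) : TcThermcert1.ThermalStiffnessCeilingU8b10_le_1o8 := by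
  rw [k1_iff_finite]
  intro ρ θ₀ hρ hθ
  rw [(k1WithoutTendstoPos_iff_empty.1 h) ρ θ₀ hρ hθ]
  exact finite_empty

/-! ## §4 Sockets: certified tori are booked as INSTANCES -/

/-- IN: a certified quadratic floor `a θ² ≤ g_L(θ)` on `|θ| ≤ θ₀` with `β ρ ≤ a` puts `L` into `floorSet … ρ θ₀`. -/
theorem mem_floorSet_of_quadFloor {tp U n β ρ θ₀ a : ℝ} {L : ℕ} [NeZero L] (ha : β * ρ ≤ a)
    (h : ∀ θ : ℝ, |θ| ≤ θ₀ → a * θ ^ 2 ≤ fluxCostAt tp U n β L θ) : L ∈ floorSet tp U n β ρ θ₀ :=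
  mem_floorSet_iff.2 fun θ hθ => (mul_le_mul_of_nonneg_right ha (sq_nonneg θ)).trans (h θ hθ)

/-- OUT: one certified DIP `g_L(θ₁) < β ρ θ₁²` inside the window keeps `L` out of `floorSet … ρ θ₀`. -/
theorem not_mem_floorSet_of_dip {tp U n β ρ θ₀ θ₁ : ℝ} {L : ℕ} [NeZero L] (hθ₁ : |θ₁| ≤ θ₀)
    (h : fluxCostAt tp U n β L θ₁ < β * ρ * θ₁ ^ 2) : L ∉ floorSet tp U n β ρ θ₀ :=
  fun hL => absurd (mem_floorSet_iff.1 hL θ₁ hθ₁) (not_le.2 h)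

/-- OUT (paramagnetic sizes): one certified NON-POSITIVE value `g_L(θ₁) ≤ 0` at some `0 < |θ₁| ≤ θ₀` keeps `L` out of EVERY floor set
with `β ρ > 0` — the typed reason an open-shell torus (4×4 float `R_4(8) = −0.221 ± 0.030`, eng-5 FTLM) is never a member. -/
theorem not_mem_floorSet_of_nonpos {tp U n β ρ θ₀ θ₁ : ℝ} {L : ℕ} [NeZero L] (hβ : 0 < β) (hρ : 0 < ρ) (hθ₁ : |θ₁| ≤ θ₀)
    (hne : θ₁ ≠ 0) (h : fluxCostAt tp U n β L θ₁ ≤ 0) : L ∉ floorSet tp U n β ρ θ₀ :=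
  not_mem_floorSet_of_dip hθ₁ (h.trans_lt (by positivity))

/-- The CERT-3×3 certificate SHAPE, verbatim the unfolding of `TendstoDeciderL3.CertFluxCost3x3Floor` (BN-resc-1, 3a87e917446b9ce6;
FL-RULING 25's commissioned object; NOT claimed here): `∀ |θ| ≤ 1/100, 2θ² ≤ g_3(θ)`. Stated unfolded so that this file imports only
`Disproof.lean`; every theorem below applies to `h : CertFluxCost3x3Floor` as is (definitional unfolding of `FluxCostQuadFloorAt`/`fluxCost`). -/
theorem mem_floorSet_three_of_cert3
    (h : ∀ θ : ℝ, |θ| ≤ 1 / 100 → 2 * θ ^ 2 ≤ thermalFluxLogZ 3 0 8 (1 - 7 / 8) 10 0 - thermalFluxLogZ 3 0 8 (1 - 7 / 8) 10 θ) :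
    3 ∈ floorSet 0 8 (7 / 8) 10 (1 / 5) (1 / 100) :=
  mem_floorSet_of_quadFloor (by norm_num) fun θ hθ => h θ hθ

/-- … hence `3 ∈ floorSet_m` at `m = 99` (`ρ_99 = 1/8 + 1/100 ≤ 1/5`, `θ_99 = 1/100`). -/
theorem mem_floorSet_99_of_cert3
    (h : ∀ θ : ℝ, |θ| ≤ 1 / 100 → 2 * θ ^ 2 ≤ thermalFluxLogZ 3 0 8 (1 - 7 / 8) 10 0 - thermalFluxLogZ 3 0 8 (1 - 7 / 8) 10 θ) :
    3 ∈ floorSet 0 8 (7 / 8) 10 (1 / 8 + 1 / (((99 : ℕ) : ℝ) + 1)) (1 / (((99 : ℕ) : ℝ) + 1)) :=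
  floorSet_anti (by norm_num) (by norm_num) (by norm_num) (mem_floorSet_three_of_cert3 h)

/-- … which is exactly why CERT-3×3 decides `K1WithoutTendstoPos` in the NEGATIVE (the floor set at `ρ = 1/5 > 1/8` is non-empty;
re-derivation of `TendstoDeciderL3.not_k1WithoutTendstoPos_of_cert3` through the normal form) … -/
theorem not_k1WithoutTendstoPos_of_cert3'
    (h : ∀ θ : ℝ, |θ| ≤ 1 / 100 → 2 * θ ^ 2 ≤ thermalFluxLogZ 3 0 8 (1 - 7 / 8) 10 0 - thermalFluxLogZ 3 0 8 (1 - 7 / 8) 10 θ) :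
    ¬ K1WithoutTendstoPos := fun hK =>
  (eq_empty_iff_forall_notMem.1 ((k1WithoutTendstoPos_iff_empty.1 hK) (1 / 5) (1 / 100) (by norm_num) (by norm_num)) 3)
    (mem_floorSet_three_of_cert3 h)

/-- … and exactly why it says nothing about K1: K1 is equivalent to its own restriction to sizes `L ≥ 4` (`k1_iff_tail 4`). -/
theorem k1_iff_sizes_ge_four :
    TcThermcert1.ThermalStiffnessCeilingU8b10_le_1o8 ↔
      ∀ ρ θ₀ : ℝ, 1 / 8 < ρ → 0 < θ₀ → BddAbove (floorSet 0 8 (7 / 8) 10 ρ θ₀ ∩ Ici 4) :=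
  k1_iff_tail 4


end Summit.Ventures.CertifiedManyBodySolver.Cruxes.ThermalStiffnessCeilingU8b10_le_1o8.FloorSetNormalForm

end
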